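import Summits.CriticalPhenomena.PercolationContinuityZ3.Theorems.PercNearOneGluingNoHeavyLowerTailFrontierDecRowsEdgeInduction
import HarnessLib

/-!
# Sahi's `E₃` along one edge: the exact deletion–contraction identity and the chord (DM₃) reduction;
# the increasing star `E₃({s↔b},{s↔c},{s↔y})`

Support file for the Sahi programme (`--supports stmt-CriticalPhenomena-4575`, prover prim-sahi-p2 gen 4).  No definitions,
no named facts, no sorries; standard axioms.  Memo: `run/shared/lean/prim/prim-sahi/FROM-prim-sahi-p2-gen4-INC-STAR.md`,
`prim-sahi-p2/PROOF-E3.md` §15.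

For Bernoulli bond percolation `P_w` on a finite vertex set `Fin n`, three arbitrary events `A B C` and one pair `e` with weight
`p = w e`, write `P₀ = P_{w[e↦0]}`, `P₁ = P_{w[e↦1]}`, `π_S = P₁(S) − P₀(S)` ("pivotality" of `e` for `S`) and `α_S = P₀(S)`.  Then
(`sahiE3_oneBond_identity`)

  `E₃(P_w) = (1 − p)·E₃(P₀) + p·E₃(P₁) + p(1 − p)·Λ`,
  `Λ = π_A π_{B∩C} + π_B π_{A∩C} + π_C π_{A∩B} − (α_A π_B π_C + α_B π_A π_C + α_C π_A π_B) − (1 + p) π_A π_B π_C`,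

a one-line consequence of the one-bond decomposition `P_w(S) = (1−p)P₀(S) + p P₁(S)` (tree: `stub_oneBondDecomp_k15`).  `Λ ≥ 0` says
that the cubic `p ↦ E₃` lies above its chord on `[0,1]` (the "DM₃" relations `3B₁ ≥ 2B₀ + B₃`, `3B₂ ≥ B₀ + 2B₃` of its Bernstein coefficients).
Since `E₃` vanishes at every deterministic weight (tree: `EdgeInduction.sahiE3_eq_zero_of_zeroOne`, prim-l12-p1), the chord inequality along every edge implies `E₃ ≥ 0` for every
weight by induction on the number of fractional weights (`sahiE3_nonneg_of_edgeChord`); `incStar_nonneg_of_edgeChord` is the instance for the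
increasing star `A = {s↔b}, B = {s↔c}, C = {s↔y}` (masterthm orbit finc47).  CAUTION (added 2026-08-20 ~12:10Z): the chord hypothesis 'at EVERY
edge' is FALSE for the increasing star on some simple weighted graphs with `n ≥ 8` vertices (ttrl2 cp-istar witness family `W2(k)`,
run/shared/lean/ttrl/istar/) although it holds exhaustively for `n ≤ 7`; so `incStar_nonneg_of_edgeChord` is recorded only as the algebraic
skeleton — the valid route is the weaker Bernstein form along ROOT edges (`…IncStarRootEdgeInduction`, `…IncStarRootTargetStep`,
`…IncStarOfRootUnmarked`).  The identity `sahiE3_oneBond_identity` is unconditional.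
-/

namespace Summit.CriticalPhenomena.PercolationContinuityZ3.Theorems

namespace IncStar

open MeasureTheory Set Literature.Probability.LatticeModels Literature.Probability.Percolation
open scoped Classical

noncomputable section

variable {n : ℕ}

/-- **One-bond identity for Sahi's `E₃`.**  For every weight `w`, pair `e` and events `A B C`:
`E₃(P_w) = (1−p)E₃(P_{w[e↦0]}) + pE₃(P_{w[e↦1]}) + p(1−p)Λ` with `p = w e` and `Λ` the explicit "pivotality" form displayed in the
module docstring. [this work] -/
theorem sahiE3_oneBond_identity (w : Sym2 (Fin n) → unitInterval) (e : Sym2 (Fin n))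
    (A B C : Set (BondConfig (Fin n))) :
    sahiE3 (prodBernoulli w) A B C =
      (1 - (w e : ℝ)) * sahiE3 (prodBernoulli (Function.update w e 0)) A B C +
        (w e : ℝ) * sahiE3 (prodBernoulli (Function.update w e 1)) A B C +
        (w e : ℝ) * (1 - (w e : ℝ)) *
          ( ((prodBernoulli (Function.update w e 1)).real A - (prodBernoulli (Function.update w e 0)).real A) *
              ((prodBernoulli (Function.update w e 1)).real (B ∩ C) - (prodBernoulli (Function.update w e 0)).real (B ∩ C)) +
            ((prodBernoulli (Function.update w e 1)).real B - (prodBernoulli (Function.update w e 0)).real B) *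
              ((prodBernoulli (Function.update w e 1)).real (A ∩ C) - (prodBernoulli (Function.update w e 0)).real (A ∩ C)) +
            ((prodBernoulli (Function.update w e 1)).real C - (prodBernoulli (Function.update w e 0)).real C) *
              ((prodBernoulli (Function.update w e 1)).real (A ∩ B) - (prodBernoulli (Function.update w e 0)).real (A ∩ B))
            - ( (prodBernoulli (Function.update w e 0)).real A *
                  ((prodBernoulli (Function.update w e 1)).real B - (prodBernoulli (Function.update w e 0)).real B) *
                  ((prodBernoulli (Function.update w e 1)).real C - (prodBernoulli (Function.update w e 0)).real C) +
                (prodBernoulli (Function.update w e 0)).real B *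
                  ((prodBernoulli (Function.update w e 1)).real A - (prodBernoulli (Function.update w e 0)).real A) *
                  ((prodBernoulli (Function.update w e 1)).real C - (prodBernoulli (Function.update w e 0)).real C) +
                (prodBernoulli (Function.update w e 0)).real C *
                  ((prodBernoulli (Function.update w e 1)).real A - (prodBernoulli (Function.update w e 0)).real A) *
                  ((prodBernoulli (Function.update w e 1)).real B - (prodBernoulli (Function.update w e 0)).real B) )
            - (1 + (w e : ℝ)) *
                ((prodBernoulli (Function.update w e 1)).real A - (prodBernoulli (Function.update w e 0)).real A) *
                ((prodBernoulli (Function.update w e 1)).real B - (prodBernoulli (Function.update w e 0)).real B) *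
                ((prodBernoulli (Function.update w e 1)).real C - (prodBernoulli (Function.update w e 0)).real C) ) := by
  simp only [sahiE3_def]
  rw [stub_oneBondDecomp_k15 n w e (A ∩ B ∩ C), stub_oneBondDecomp_k15 n w e A, stub_oneBondDecomp_k15 n w e B,
    stub_oneBondDecomp_k15 n w e C, stub_oneBondDecomp_k15 n w e (B ∩ C), stub_oneBondDecomp_k15 n w e (A ∩ C),
    stub_oneBondDecomp_k15 n w e (A ∩ B)]
  ring

/-- The number of fractional weights (`w e ∉ {0,1}`). -/
private theorem card_update_lt (w : Sym2 (Fin n) → unitInterval) (e : Sym2 (Fin n)) (he : w e ≠ 0 ∧ w e ≠ 1)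
    (b : unitInterval) (hb : b = 0 ∨ b = 1) :
    (Finset.univ.filter (fun f => Function.update w e b f ≠ 0 ∧ Function.update w e b f ≠ 1)).card <
      (Finset.univ.filter (fun f => w f ≠ 0 ∧ w f ≠ 1)).card := by
  apply Finset.card_lt_card
  rw [Finset.ssubset_iff_of_subset]
  · refine ⟨e, ?_, ?_⟩
    · simp only [Finset.mem_filter, Finset.mem_univ, true_and]; exact he
    · simp only [Finset.mem_filter, Finset.mem_univ, true_and, Function.update_self, not_and, not_not]
      intro h0; rcases hb with h | h
      · exact absurd h h0
      · exact h
  · intro f hf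
    simp only [Finset.mem_filter, Finset.mem_univ, true_and] at hf ⊢
    by_cases hfe : f = e
    · subst hfe; simp only [Function.update_self] at hf
      rcases hb with h | h
      · exact absurd h hf.1
      · exact absurd h hf.2
    · rwa [Function.update_of_ne hfe] at hf

/-- **Chord (DM₃) reduction for `E₃`.**  Fix three events `A B C` on the configurations of `Fin n`.  If for every weight `w` and every
pair `e` the cubic `p ↦ E₃` in the weight of `e` lies above its chord, i.e.
`(1 − w e)·E₃(P_{w[e↦0]}) + (w e)·E₃(P_{w[e↦1]}) ≤ E₃(P_w)`, then `E₃(P_w)(A,B,C) ≥ 0` for every weight `w`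
(induction on the number of fractional weights; base case `EdgeInduction.sahiE3_eq_zero_of_zeroOne`).  Companion of
`EdgeInduction.sahiE3_nonneg_of_edgeBernstein` (Bernstein-coefficient hypotheses) and of `IncStar.incStar_nonneg_of_rootEdgeBernstein`
(root edges only). [this work] -/
theorem sahiE3_nonneg_of_edgeChord (A B C : Set (BondConfig (Fin n)))
    (hchord : ∀ (w : Sym2 (Fin n) → unitInterval) (e : Sym2 (Fin n)),
      (1 - (w e : ℝ)) * sahiE3 (prodBernoulli (Function.update w e 0)) A B C +
          (w e : ℝ) * sahiE3 (prodBernoulli (Function.update w e 1)) A B C ≤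
        sahiE3 (prodBernoulli w) A B C)
    (w : Sym2 (Fin n) → unitInterval) : 0 ≤ sahiE3 (prodBernoulli w) A B C := by
  -- strong induction on the number of fractional weights
  suffices H : ∀ (k : ℕ) (w : Sym2 (Fin n) → unitInterval),
      (Finset.univ.filter (fun f => w f ≠ 0 ∧ w f ≠ 1)).card = k → 0 ≤ sahiE3 (prodBernoulli w) A B C from
    H _ w rfl
  intro k
  induction k using Nat.strong_induction_on with
  | _ k ih =>
    intro w hk
    by_cases hfrac : ∃ e, w e ≠ 0 ∧ w e ≠ 1
    · obtain ⟨e, he⟩ := hfrac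
      have h0 := ih _ (hk ▸ card_update_lt w e he 0 (Or.inl rfl)) (Function.update w e 0) rfl
      have h1 := ih _ (hk ▸ card_update_lt w e he 1 (Or.inr rfl)) (Function.update w e 1) rfl
      have hp0 : 0 ≤ (w e : ℝ) := unitInterval.nonneg (w e)
      have hp1 : (w e : ℝ) ≤ 1 := unitInterval.le_one (w e)
      calc (0 : ℝ) ≤ (1 - (w e : ℝ)) * sahiE3 (prodBernoulli (Function.update w e 0)) A B C +
            (w e : ℝ) * sahiE3 (prodBernoulli (Function.update w e 1)) A B C := by
              have : 0 ≤ 1 - (w e : ℝ) := by linarith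
              positivity
        _ ≤ sahiE3 (prodBernoulli w) A B C := hchord w e
    · push Not at hfrac
      have hw : ∀ e, w e = 0 ∨ w e = 1 := by
        intro e
        by_cases h0 : w e = 0
        · exact Or.inl h0
        · exact Or.inr (hfrac e h0)
      rw [EdgeInduction.sahiE3_eq_zero_of_zeroOne w hw]

/-- **The increasing star, conditionally on its single-edge chord inequality.**  If for every finite weighted graph on `Fin n`,
every pair `e` and all vertices `s b c y` the inc-star cubic `p_e ↦ E₃(P_w)({s↔b},{s↔c},{s↔y})` lies above its chord
(hypothesis known to FAIL at some edges of some graphs with `n ≥ 8` — see the module docstring; kept as the algebraic skeleton), then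
`E₃({s↔b},{s↔c},{s↔y}) ≥ 0` on every weighted graph on `Fin n`. [this work] -/
theorem incStar_nonneg_of_edgeChord
    (hchord : ∀ (w : Sym2 (Fin n) → unitInterval) (e : Sym2 (Fin n)) (s b c y : Fin n),
      (1 - (w e : ℝ)) * sahiE3 (prodBernoulli (Function.update w e 0)) (openConn s b) (openConn s c) (openConn s y) +
          (w e : ℝ) * sahiE3 (prodBernoulli (Function.update w e 1)) (openConn s b) (openConn s c) (openConn s y) ≤
        sahiE3 (prodBernoulli w) (openConn s b) (openConn s c) (openConn s y))
    (w : Sym2 (Fin n) → unitInterval) (s b c y : Fin n) :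
    0 ≤ sahiE3 (prodBernoulli w) (openConn s b) (openConn s c) (openConn s y) :=
  sahiE3_nonneg_of_edgeChord _ _ _ (fun w' e => hchord w' e s b c y) w

end

end IncStar

end Summit.CriticalPhenomena.PercolationContinuityZ3.Theorems
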